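import Summits.ResolutionOfSingularities.ResolutionOfSingularities.Theorems.DeltaCutGradeCertificates3
import HarnessLib

/-!
# MirrorCensus — decomp-res lens-6 g29 NODE «MirrorCut»: chart identities behind the REPAIR CENSUS (NODE-g29.md §3, §4, §7)

HOME file `decomp-res-lens-6/g29/MirrorCensus.lean` (companion of `MirrorCut.lean`; same imports and namespace;
section `MCensus`).  Ring
identities only (every exponent `p`; the `H` identities at exponent 3), turning hand cells of the census into
machine-checked sentences:
* ℓ₃ «blow up the closed point»: chart `u` of the point blow-up takes `D′_p` to `u^p·(z^p + u^{p+1}·t^p·w^p)` —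
THREE planes in the top
  locus of the controlled transform (`mirrorF_pointChart_u`); worse, as in Kollár's Example 3.6.2 for `m ≥ 3`.
* ℓ₄ «blow up the whole (singular) surface part `(z, t·w)`»: the smooth Rees chart `z = t·w·X` takes `D′_p` to `t^p
w^p·(X^p + u)`
  (`mirrorF_sigmaChart`) — the controlled transform `X^p + u` is regular: the singular centre «decides» `D′_p` at
the price of the other,
  singular, Rees chart (hand).
* Kollár's objection (ii), the NODAL specimen `N_p = z^p + u·g^p`, `g = t·w + t³ + w³` (ONE irreducible surface
`V(z,g)` in the top locus,
  two branches along the `u`-axis): mirror and Frobenius shears (`nodalF_swap`, `nodalF_shear`), and the axis blow-up chart `t`: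
  `t^p·(z^p + u·t^p·(w + t(1+w³))^p)` (`nodalF_axisChart_t`) — étale-locally the marked mirror crossing.
* the hand-off of `H = z³ + (t²w − u²)⁴` under the one-bit law (NODE-g29.md §3): `H_axisChart_t` (blow up `V(z,t,u)`, chart `t`:
  `t³·(z³ + t⁵(w − u²)⁴)`), `H1_straighten` (`w ↦ w + u²`), `H1_oldChart_w` (blow up `V(z,w)`, chart `w`: `w³·(z³ +
t⁵w)`), `H2_newChart_t`
  (blow up `V(z,t)`, chart `t`: `t³·(z³ + t²w)`) — the last germ's order-3 locus is the LINE `V(z,t,w)`: the curve regime.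
[new; elementary] [folklore]
-/


noncomputable section

open CategoryTheory CategoryTheory.Limits AlgebraicGeometry TopologicalSpace IsLocalRing
open Literature.AlgebraicGeometry.Resolution

universe u

namespace Summit.ResolutionOfSingularities.ResolutionOfSingularities.Theorems.DeltaCutClasses

open Summit.ResolutionOfSingularities.ResolutionOfSingularities.Theorems.TwistCutClasses
open Summit.ResolutionOfSingularities.ResolutionOfSingularities.Theorems.LightCutClasses

section MCensus

open MvPolynomial
variable {K : Type*} [Field K]

/-! #### ℓ₃ and ℓ₄ on `D′_p` -/

/-- **ℓ₃ — POINT BLOW-UP, chart `u`**: `D′_p(z·u, t·u, u, w·u) = u^p·(z^p + u^{p+1}·t^p·w^p)`: the controlled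
transform has THREE planes
`V(z,u)`, `V(z,t)`, `V(z,w)` of order `p` (worse). [new; elementary] [folklore] -/
theorem mirrorF_pointChart_u (p : ℕ) :
    aeval (chartSubst (K := K) 2) (X 0 ^ p + X 2 * X 1 ^ p * X 3 ^ p : MvPolynomial (Fin 4) K) =
      X 2 ^ p * (X 0 ^ p + X 2 ^ (p + 1) * X 1 ^ p * X 3 ^ p) := by
  simp [chartSubst]; ring

/-- **ℓ₄ — BLOW-UP OF THE SINGULAR CENTRE `(z, t·w)`, smooth Rees chart `z = t·w·X`** (`X` written in the slot of
`z`): `D′_p ↦ t^p·w^p·(X^p + u)`;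
the controlled transform `X^p + u` is REGULAR (`∂_u = 1`). [new; elementary] [folklore] -/
theorem mirrorF_sigmaChart (p : ℕ) :
    aeval (fun j : Fin 4 => if j = 0 then (X 1 * X 3 * X 0 : MvPolynomial (Fin 4) K) else X j)
        (X 0 ^ p + X 2 * X 1 ^ p * X 3 ^ p : MvPolynomial (Fin 4) K) =
      X 1 ^ p * X 3 ^ p * (X 0 ^ p + X 2) := by
  have h1 : (1 : Fin 4) ≠ 0 := by decide
  have h2 : (2 : Fin 4) ≠ 0 := by decide
  have h3 : (3 : Fin 4) ≠ 0 := by decide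
  simp [h1, h2, h3]; ring

/-! #### Kollár's objection (ii): the NODAL specimen `N_p = z^p + u·(t·w + t³ + w³)^p` -/

/-- **THE NODAL DATUM** `N_p`. DEFINITION (support). -/
def nodalF (p : ℕ) : MvPolynomial (Fin 4) K := X 0 ^ p + X 2 * (X 1 * X 3 + X 1 ^ 3 + X 3 ^ 3) ^ p

/-- the MIRROR fixes `N_p`. [new; elementary] [folklore] -/
theorem nodalF_swap (p : ℕ) : rename (Equiv.swap 1 3) (nodalF (K := K) p) = nodalF p := by
  simp [nodalF, rename_X, Equiv.swap_apply_def]; ring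

/-- the FROBENIUS SHEARS `z ↦ z − c·g, u ↦ u + c^p` fix `N_p` in characteristic `p`. [new; elementary] [folklore] -/
theorem nodalF_shear (p : ℕ) [Fact p.Prime] [CharP K p] (c : K) :
    aeval (fun j : Fin 4 => if j = 0 then (X 0 - C c * (X 1 * X 3 + X 1 ^ 3 + X 3 ^ 3) : MvPolynomial (Fin 4) K)
        else if j = 2 then X 2 + C (c ^ p) else X j) (nodalF (K := K) p) = nodalF p := by
  simp only [nodalF, map_add, map_mul, map_pow, aeval_X, Fin.isValue, if_true,
    show (2 : Fin 4) ≠ 0 by decide, show (1 : Fin 4) ≠ 0 by decide, show (1 : Fin 4) ≠ 2 by decide, show (3 : Fin 4) ≠ 0 by decide,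
    show (3 : Fin 4) ≠ 2 by decide, if_false]
  rw [sub_pow_char (X 0 : MvPolynomial (Fin 4) K) (C c * (X 1 * X 3 + X 1 ^ 3 + X 3 ^ 3)), mul_pow]
  ring

/-- **AXIS BLOW-UP, chart `t`**: `N_p(z·t, t, u, w·t) = t^p·(z^p + u·t^p·(w + t·(1 + w³))^p)` — the top locus of the
controlled transform is the
crossing of the NEW plane `V(z,t)` and the OLD regular surface `V(z, w + t(1+w³))`, étale-locally the marked mirror
datum. [new; elementary] [folklore] -/
theorem nodalF_axisChart_t (p : ℕ) :
    aeval (linChartSubst (K := K) {0, 1, 3} 1) (nodalF (K := K) p) =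
      X 1 ^ p * (X 0 ^ p + X 2 * X 1 ^ p * (X 3 + X 1 * (1 + X 3 ^ 3)) ^ p) := by
  simp [nodalF, linChartSubst]
  have e : (X 1 * (X 3 * X 1) + X 1 ^ 3 + (X 3 * X 1) ^ 3 : MvPolynomial (Fin 4) K) =
      X 1 ^ 2 * (X 3 + X 1 * (1 + X 3 ^ 3)) := by ring
  have e2 : (X 1 ^ 2 * (X 3 + X 1 * (1 + X 3 ^ 3)) : MvPolynomial (Fin 4) K) ^ p =
      X 1 ^ p * X 1 ^ p * (X 3 + X 1 * (1 + X 3 ^ 3)) ^ p := by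
    rw [mul_pow, ← pow_mul, two_mul, pow_add]
  rw [e, e2]
  ring

/-! #### the hand-off of `H = z³ + (t²w − u²)⁴` under the one-bit law (exponent 3; characteristic-free identities) -/

/-- **step 1 — blow up the umbrella's singular line `V(z,t,u)`, chart `t`**: `H(z·t, t, u·t, w) = t³·(z³ + t⁵·(w −
u²)⁴)`. [new; elementary]
[folklore] -/
theorem H_axisChart_t :
    aeval (linChartSubst (K := K) {0, 1, 2} 1) (X 0 ^ 3 + (X 1 ^ 2 * X 3 - X 2 ^ 2) ^ 4 : MvPolynomial (Fin 4) K) =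
      X 1 ^ 3 * (X 0 ^ 3 + X 1 ^ 5 * (X 3 - X 2 ^ 2) ^ 4) := by
  simp [linChartSubst]
  have e : ((X 1 : MvPolynomial (Fin 4) K) ^ 2 * X 3 - (X 2 * X 1) ^ 2) = X 1 ^ 2 * (X 3 - X 2 ^ 2) := by ring
  rw [e]; ring

/-- **straightening the OLD component** `w ↦ w + u²`: `z³ + t⁵(w − u²)⁴ ↦ z³ + t⁵w⁴`. [new; elementary] [folklore] -/
theorem H1_straighten :
    aeval (fun j : Fin 4 => if j = 3 then (X 3 + X 2 ^ 2 : MvPolynomial (Fin 4) K) else X j)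
        (X 0 ^ 3 + X 1 ^ 5 * (X 3 - X 2 ^ 2) ^ 4 : MvPolynomial (Fin 4) K) = X 0 ^ 3 + X 1 ^ 5 * X 3 ^ 4 := by
  have h0 : (0 : Fin 4) ≠ 3 := by decide
  have h1 : (1 : Fin 4) ≠ 3 := by decide
  have h2 : (2 : Fin 4) ≠ 3 := by decide
  simp [h0, h1, h2]

/-- **step 2 — blow up the OLD (now regular) component `V(z,w)`, chart `w`**: `z³ + t⁵w⁴ ↦ w³·(z³ + t⁵·w)`. [new;
elementary] [folklore] -/
theorem H1_oldChart_w :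
    aeval (linChartSubst (K := K) {0, 3} 3) (X 0 ^ 3 + X 1 ^ 5 * X 3 ^ 4 : MvPolynomial (Fin 4) K) =
      X 3 ^ 3 * (X 0 ^ 3 + X 1 ^ 5 * X 3) := by
  simp [linChartSubst]; ring

/-- **step 3 — blow up the NEW plane `V(z,t)`, chart `t`**: `z³ + t⁵w ↦ t³·(z³ + t²·w)` — the order-3 locus of `z³ +
t²w` is the LINE
`V(z,t,w)`: the run has left the F-surf-sing door for the curve regime. [new; elementary] [folklore] -/
theorem H2_newChart_t :
    aeval (linChartSubst (K := K) {0, 1} 1) (X 0 ^ 3 + X 1 ^ 5 * X 3 : MvPolynomial (Fin 4) K) =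
      X 1 ^ 3 * (X 0 ^ 3 + X 1 ^ 2 * X 3) := by
  simp [linChartSubst]; ring

end MCensus

end Summit.ResolutionOfSingularities.ResolutionOfSingularities.Theorems.DeltaCutClasses
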